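import Literature.NumberTheory.GaloisCohomology.Howard2004.ResidualTauCohomologyProofs
import Literature.Algebra.Module.IsotropicLineParity
import Mathlib.RingTheory.Length
import HarnessLib

/-!
# Howard 2004, Lemma 1.5.3 («parity») in eigen-Selmer currency: `ρ(nℓ)^± = ρ(n)^± ∓ 1` from the
# eigenline form of global duality and the isotropy dichotomy (theorems only)

Topic `NumberTheory/GaloisCohomology/Howard2004`. THEOREMS ONLY: no definition, no named fact, no
instance, no notation, no `sorry`. Cell `pub/bsd-print-x9`, print leaf G87
`Literature.NumberTheory.GaloisCohomology.Howard2004.thm161_dvrKolyvaginBound` (Howard Thm. 1.6.1);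
seat `bsd-line-x10b-p1-w5` g7, third file of the Lemma 1.5.3 line (after
`Algebra/Module/IsotropicLineParity.lean` = the module-theoretic core and
`ResidualTauCohomologyProofs.lean` = `τ` on `H¹(K, T̄)`).

SOURCE. B. Howard, Compositio Math. **140** (2004) = arXiv:1202.6340, Def. 1.5.2 («`ρ(n)^±` the
`R/𝔪`-dimension of `𝓗̄(n)^±`») and Lemma 1.5.3 (arXiv 2.5.3, p. 9 L139 – p. 10 L45): «For any
`nℓ ∈ 𝓝`: (a) if `loc_ℓ(𝓗̄(n)^±) ≠ 0` then `ρ(nℓ)^± = ρ(n)^± − 1` and `loc_ℓ(𝓗̄(nℓ)^±) = 0`; (b) if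
`loc_ℓ(𝓗̄(n)^±) = 0` then `ρ(nℓ)^± = ρ(n)^± + 1`.»

DICTIONARY. `S = H¹_{𝓕^ℓ(n)}(K, T̄)` (the structure RELAXED at the inert prime `q = λ ∣ ℓ`), an additive
subgroup of `H¹(K, T̄)` stable under the scalars `R` (`scalarMapH1`); `E` = an eigen-subgroup
`H¹(K, T̄)^± = ker(τ_* ∓ 1)` of the involution `τ_*` of `ResidualTauCohomologyProofs` (any `R`-stable
subgroup will do — §1 shows the two eigen-subgroups are `R`-stable); `loc = loc_q`; `Lf`, `Lt` = the
finite and the transverse condition at `q`, `R`-stable and DISJOINT subgroups of `H¹(K_q, T̄)`; then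
`𝓗̄(n)^± = S ⊓ E ⊓ loc⁻¹(Lf)` and `𝓗̄(nℓ)^± = S ⊓ E ⊓ loc⁻¹(Lt)` (the Selmer groups of structures agreeing
off one place: `SelmerStructure`-level identities of the companion file of seat x9-p1-w3,
`SelmerStructureOnePlaceComparisonProofs`), and `ρ(·)^± = Module.length R` of these for the functorial
`R`-module structure `galoisCohomology.moduleH1` (`submoduleOfStable`). INPUTS (hypotheses, each a
separate Galois brick): **(GD-line)** `Module.length R loc(S ⊓ E) = 1` — the Poitou–Tate complement
statement for the pair `𝓕_ℓ(n) ≤ 𝓕(n)` read on the `±`-eigenline pair `H¹_f(K_ℓ, T̄)^± × H¹_s(K_ℓ, T̄)^±`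
(Thm. 1.1.11 + Prop. 1.1.7 + H.5(a)); **(DICH)** `loc(S ⊓ E) ≤ Lf ∨ loc(S ⊓ E) ≤ Lt` — the «elementary
linear algebra exercise» (`Submodule.le_or_le_of_isotropic` of `IsotropicLineParity`) fed by the
isotropy «`⟨c_ℓ, c_ℓ⟩_ℓ = 0`» (`RelaxedSelmerIsotropyProofs`) and the eigenline structure at `q`.

WHAT IS PROVED.
* §1 `scalarMapH1_mem_ker_sub` / `scalarMapH1_mem_ker_add`: the eigen-subgroups
  `ker(τ_* − id)`, `ker(τ_* + id)` of `H¹(K, T̄)` are `R`-stable (from `semilinearH_scalarMapH1`), and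
  `mem_ker_sub_iff` / `mem_ker_add_iff` (membership = `τ_* c = c`, resp. `τ_* c = -c`).
* §2 **`length_inf_comap_add_one_eq_of_exists`** (Lemma 1.5.3 (a)): under (GD-line) and (DICH), if some
  `c ∈ S ⊓ E` has `loc c ∈ Lf`, `loc c ≠ 0`, then
  `length (S ⊓ E ⊓ loc⁻¹ Lt) + 1 = length (S ⊓ E ⊓ loc⁻¹ Lf)` and `loc(S ⊓ E ⊓ loc⁻¹ Lt) = 0`;
  **`length_inf_comap_eq_add_one_of_forall`** (Lemma 1.5.3 (b)): if every `c ∈ S ⊓ E` with `loc c ∈ Lf`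
  has `loc c = 0`, then `length (S ⊓ E ⊓ loc⁻¹ Lt) = length (S ⊓ E ⊓ loc⁻¹ Lf) + 1`. (Generic: any
  `R`-linear discrete Galois module `ρ`, any place `q`, any `R`-stable `S`, `E`, `Lf`, `Lt`.)

NOT HERE: the inputs (GD-line), (DICH), the eigenline structure at `q`, the `SelmerStructure`-level
identities; `thm161_dvrKolyvaginBound` is NOT proved; no summit statement is proved; the
Birch–Swinnerton-Dyer conjecture is not proved by any of this.
References: [Howard2004HeegnerKolyvagin] Def. 1.5.2, Lemma 1.5.3; [SerreGaloisCohomology1997] I §2.2.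
-/

set_option autoImplicit false

noncomputable section

open Function NumberField IsDedekindDomain Field
open scoped NumberField

namespace Literature.NumberTheory.GaloisCohomology.Howard2004

open Literature.NumberTheory.GaloisRepresentations
open Literature.NumberTheory.GaloisRepresentations.DiscreteGaloisModule
open Literature.NumberTheory.EllipticCurves

variable {K : Type} [Field K] [NumberField K] {M : Type} [AddCommGroup M] [TopologicalSpace M]
  [DiscreteTopology M] {R : Type} [CommRing R] [Module R M]

/-! ## §1 The eigen-subgroups of `τ_*` are `R`-stable -/

namespace ResidualTau

variable {cd : ConjugationDatum K} {ρbar : DiscreteGaloisModule K M}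

/-- `c ∈ ker(τ_* − id) ↔ τ_* c = c`. [cite: Howard2004HeegnerKolyvagin, §1.5 preamble (arXiv p. 9 L122–126: «`M⁺` … the subspace on which `τ` acts by `+1`»)] -/
theorem mem_ker_sub_iff (A : ResidualTau (R := R) cd ρbar) (c : galoisCohomology ρbar 1) :
    c ∈ (semilinearH cd.isLift A.θ.toAddMonoidHom A.isSemilinear 1 - AddMonoidHom.id _).ker ↔
      semilinearH cd.isLift A.θ.toAddMonoidHom A.isSemilinear 1 c = c := by
  rw [AddMonoidHom.mem_ker, AddMonoidHom.sub_apply, AddMonoidHom.id_apply, sub_eq_zero]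

/-- `c ∈ ker(τ_* + id) ↔ τ_* c = -c`. [cite: Howard2004HeegnerKolyvagin, §1.5 preamble (arXiv p. 9 L122–126: «`M⁻` … the subspace on which `τ` acts by `−1`»)] -/
theorem mem_ker_add_iff (A : ResidualTau (R := R) cd ρbar) (c : galoisCohomology ρbar 1) :
    c ∈ (semilinearH cd.isLift A.θ.toAddMonoidHom A.isSemilinear 1 + AddMonoidHom.id _).ker ↔
      semilinearH cd.isLift A.θ.toAddMonoidHom A.isSemilinear 1 c = -c := by
  rw [AddMonoidHom.mem_ker, AddMonoidHom.add_apply, AddMonoidHom.id_apply, add_eq_zero_iff_eq_neg]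

/-- **`H¹(K, T̄)⁺ = ker(τ_* − id)` is `R`-stable** (`τ_*` commutes with the scalars).
[cite: Howard2004HeegnerKolyvagin, §1.5 preamble and Def. 1.5.2 (arXiv p. 9 L122–135)] -/
theorem scalarMapH1_mem_ker_sub (A : ResidualTau (R := R) cd ρbar) (hlin : ρbar.IsScalarLinear R)
    (r : R) {c : galoisCohomology ρbar 1}
    (hc : c ∈ (semilinearH cd.isLift A.θ.toAddMonoidHom A.isSemilinear 1 - AddMonoidHom.id _).ker) :
    galoisCohomology.scalarMapH1 ρbar hlin r c ∈
      (semilinearH cd.isLift A.θ.toAddMonoidHom A.isSemilinear 1 - AddMonoidHom.id _).ker := by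
  rw [mem_ker_sub_iff] at hc ⊢
  rw [A.semilinearH_scalarMapH1 hlin, hc]

/-- **`H¹(K, T̄)⁻ = ker(τ_* + id)` is `R`-stable**.
[cite: Howard2004HeegnerKolyvagin, §1.5 preamble and Def. 1.5.2 (arXiv p. 9 L122–135)] -/
theorem scalarMapH1_mem_ker_add (A : ResidualTau (R := R) cd ρbar) (hlin : ρbar.IsScalarLinear R)
    (r : R) {c : galoisCohomology ρbar 1}
    (hc : c ∈ (semilinearH cd.isLift A.θ.toAddMonoidHom A.isSemilinear 1 + AddMonoidHom.id _).ker) :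
    galoisCohomology.scalarMapH1 ρbar hlin r c ∈
      (semilinearH cd.isLift A.θ.toAddMonoidHom A.isSemilinear 1 + AddMonoidHom.id _).ker := by
  rw [mem_ker_add_iff] at hc ⊢
  rw [A.semilinearH_scalarMapH1 hlin, hc, map_neg]

end ResidualTau

/-! ## §2 Lemma 1.5.3 for `R`-stable subgroups `S`, `E` of `H¹(K, M)` and `Lf`, `Lt` of `H¹(K_q, M)` -/

section Parity

variable (ρ : DiscreteGaloisModule K M) (hρ : ρ.IsScalarLinear R) (q : Place K)
  (S E : AddSubgroup (galoisCohomology ρ 1))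
  (hS : ∀ (r : R) {x}, x ∈ S → galoisCohomology.scalarMapH1 ρ hρ r x ∈ S)
  (hE : ∀ (r : R) {x}, x ∈ E → galoisCohomology.scalarMapH1 ρ hρ r x ∈ E)
  (Lf Lt : AddSubgroup (galoisCohomology (ρ.toLocal q) 1))
  (hLf : ∀ (r : R) {x}, x ∈ Lf →
    galoisCohomology.scalarMapH1 (ρ.toLocal q) (hρ.restrictField (Place.Completion q)) r x ∈ Lf)
  (hLt : ∀ (r : R) {x}, x ∈ Lt →
    galoisCohomology.scalarMapH1 (ρ.toLocal q) (hρ.restrictField (Place.Completion q)) r x ∈ Lt)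

omit [NumberField K] in
/-- Stability of an intersection. [folklore] -/
private theorem stable_inf {A B : AddSubgroup (galoisCohomology ρ 1)}
    (hA : ∀ (r : R) {x}, x ∈ A → galoisCohomology.scalarMapH1 ρ hρ r x ∈ A)
    (hB : ∀ (r : R) {x}, x ∈ B → galoisCohomology.scalarMapH1 ρ hρ r x ∈ B) :
    ∀ (r : R) {x}, x ∈ A ⊓ B → galoisCohomology.scalarMapH1 ρ hρ r x ∈ A ⊓ B :=
  fun r _ hx => ⟨hA r hx.1, hB r hx.2⟩

/-- Stability of a preimage under localization. [folklore] -/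
private theorem stable_comap {L : AddSubgroup (galoisCohomology (ρ.toLocal q) 1)}
    (hL : ∀ (r : R) {x}, x ∈ L →
      galoisCohomology.scalarMapH1 (ρ.toLocal q) (hρ.restrictField (Place.Completion q)) r x ∈ L) :
    ∀ (r : R) {x}, x ∈ L.comap (galoisCohomology.localization ρ q 1) →
      galoisCohomology.scalarMapH1 ρ hρ r x ∈ L.comap (galoisCohomology.localization ρ q 1) := by
  intro r x hx
  rw [AddSubgroup.mem_comap] at hx ⊢
  rw [galoisCohomology.localization_scalarMapH1]
  exact hL r hx

/-- Stability of an image under localization. [folklore] -/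
private theorem stable_map {A : AddSubgroup (galoisCohomology ρ 1)}
    (hA : ∀ (r : R) {x}, x ∈ A → galoisCohomology.scalarMapH1 ρ hρ r x ∈ A) :
    ∀ (r : R) {x}, x ∈ A.map (galoisCohomology.localization ρ q 1) →
      galoisCohomology.scalarMapH1 (ρ.toLocal q) (hρ.restrictField (Place.Completion q)) r x ∈
        A.map (galoisCohomology.localization ρ q 1) := by
  rintro r _ ⟨y, hy, rfl⟩
  exact ⟨_, hA r hy, galoisCohomology.localization_scalarMapH1 hρ q r y⟩

/-- **Howard's Lemma 1.5.3 (a) in eigen-Selmer currency.** With `S`, `E` `R`-stable subgroups of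
`H¹(K, M)` (`S = H¹_{𝓕^ℓ(n)}(K, T̄)`, `E = H¹(K, T̄)^±`), `Lf`, `Lt` disjoint `R`-stable subgroups of
`H¹(K_q, M)` (finite / transverse condition at `q`), (GD-line) `length_R loc_q(S ⊓ E) = 1` and (DICH)
`loc_q(S ⊓ E) ≤ Lf ∨ loc_q(S ⊓ E) ≤ Lt`: if some `c ∈ S ⊓ E` has `loc_q c ∈ Lf` and `loc_q c ≠ 0`
(«`loc_ℓ(𝓗̄(n)^±) ≠ 0`») then `length (S ⊓ E ⊓ loc⁻¹ Lt) + 1 = length (S ⊓ E ⊓ loc⁻¹ Lf)`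
(«`ρ(nℓ)^± = ρ(n)^± − 1`») and `loc_q(S ⊓ E ⊓ loc⁻¹ Lt) = 0` («`loc_ℓ(𝓗̄(nℓ)^±) = 0`»).
[cite: Howard2004HeegnerKolyvagin, Lemma 1.5.3 (a) (arXiv 2.5.3, p. 9 L141–143; proof p. 10 L1–19)] -/
theorem length_inf_comap_add_one_eq_of_exists (hdis : Disjoint Lf Lt)
    (hGD : letI := galoisCohomology.moduleH1 (ρ.toLocal q) (hρ.restrictField (Place.Completion q));
      Module.length R ↥(galoisCohomology.submoduleOfStable (hρ.restrictField (Place.Completion q))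
        ((S ⊓ E).map (galoisCohomology.localization ρ q 1)) (stable_map ρ hρ q (stable_inf ρ hρ hS hE)))
        = 1)
    (hor : (S ⊓ E).map (galoisCohomology.localization ρ q 1) ≤ Lf ∨
      (S ⊓ E).map (galoisCohomology.localization ρ q 1) ≤ Lt)
    (hne : ∃ c ∈ S ⊓ E, galoisCohomology.localization ρ q 1 c ∈ Lf ∧
      galoisCohomology.localization ρ q 1 c ≠ 0) :
    (letI := galoisCohomology.moduleH1 ρ hρ;
      Module.length R ↥(galoisCohomology.submoduleOfStable hρ
          (S ⊓ E ⊓ Lt.comap (galoisCohomology.localization ρ q 1))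
          (stable_inf ρ hρ (stable_inf ρ hρ hS hE) (stable_comap ρ hρ q hLt))) + 1 =
        Module.length R ↥(galoisCohomology.submoduleOfStable hρ
          (S ⊓ E ⊓ Lf.comap (galoisCohomology.localization ρ q 1))
          (stable_inf ρ hρ (stable_inf ρ hρ hS hE) (stable_comap ρ hρ q hLf)))) ∧
      (S ⊓ E ⊓ Lt.comap (galoisCohomology.localization ρ q 1)).map
        (galoisCohomology.localization ρ q 1) = ⊥ := by
  classical
  letI instR := galoisCohomology.moduleH1 ρ hρ
  letI instL := galoisCohomology.moduleH1 (ρ.toLocal q) (hρ.restrictField (Place.Completion q))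
  letI instL' := galoisCohomology.moduleH1 (GaloisRep.restrictField (Place.Completion q) ρ)
    (hρ.restrictField (Place.Completion q))
  obtain ⟨c, hcSE, hcLf, hc0⟩ := hne
  -- the `R`-submodules
  let W : Submodule R (galoisCohomology ρ 1) :=
    galoisCohomology.submoduleOfStable hρ (S ⊓ E) (stable_inf ρ hρ hS hE)
  let Lf' : Submodule R (galoisCohomology (ρ.toLocal q) 1) :=
    galoisCohomology.submoduleOfStable (hρ.restrictField (Place.Completion q)) Lf hLf
  let Lt' : Submodule R (galoisCohomology (ρ.toLocal q) 1) :=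
    galoisCohomology.submoduleOfStable (hρ.restrictField (Place.Completion q)) Lt hLt
  -- the `R`-linear localization restricted to `W`
  let locW : W →ₗ[R] galoisCohomology (ρ.toLocal q) 1 :=
    (galoisCohomology.resₗ hρ (Place.Completion q)).domRestrict W
  have hlocW : ∀ w : W, locW w = galoisCohomology.localization ρ q 1 (w : galoisCohomology ρ 1) :=
    fun w => rfl
  have hdis' : Disjoint Lf' Lt' := by
    rw [Submodule.disjoint_def]
    intro x hxf hxt
    exact (AddSubgroup.disjoint_def.mp hdis) hxf hxt
  -- the range of `locW` is `loc(S ⊓ E)`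
  have hrange : LinearMap.range locW =
      galoisCohomology.submoduleOfStable (hρ.restrictField (Place.Completion q))
        ((S ⊓ E).map (galoisCohomology.localization ρ q 1))
        (stable_map ρ hρ q (stable_inf ρ hρ hS hE)) := by
    refine Submodule.ext fun y => ?_
    rw [LinearMap.mem_range]
    change (∃ w, locW w = y) ↔ y ∈ (S ⊓ E).map (galoisCohomology.localization ρ q 1)
    rw [AddSubgroup.mem_map]
    constructor
    · rintro ⟨w, rfl⟩
      exact ⟨w, w.2, (hlocW w).symm⟩
    · rintro ⟨x, hx, rfl⟩
      exact ⟨⟨x, hx⟩, hlocW _⟩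
  have hor' : LinearMap.range locW ≤ Lf' ∨ LinearMap.range locW ≤ Lt' := by
    rw [hrange]
    rcases hor with h | h
    · exact Or.inl fun y hy => h hy
    · exact Or.inr fun y hy => h hy
  have hne' : (Lf'.comap locW).map locW ≠ ⊥ := by
    intro h
    apply hc0
    have hmem : locW ⟨c, hcSE⟩ ∈ (Lf'.comap locW).map locW :=
      Submodule.mem_map_of_mem (show (⟨c, hcSE⟩ : W) ∈ Lf'.comap locW from hcLf)
    rw [h, Submodule.mem_bot] at hmem
    exact hmem
  have hGD' : Module.length R (LinearMap.range locW) = 1 := by rw [hrange]; exact hGD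
  obtain ⟨hlen, hbot⟩ :=
    Literature.Algebra.Module.LinearMap.length_comap_add_length_range_eq_of_map_comap_ne_bot locW
      hdis' hor' hne'
  rw [hGD'] at hlen
  -- identify the two comaps with the subgroups `S ⊓ E ⊓ loc⁻¹ L`
  have hident : ∀ (L : AddSubgroup (galoisCohomology (ρ.toLocal q) 1))
      (hL : ∀ (r : R) {x}, x ∈ L →
        galoisCohomology.scalarMapH1 (ρ.toLocal q) (hρ.restrictField (Place.Completion q)) r x ∈ L),
      Module.length R ↥((galoisCohomology.submoduleOfStable (hρ.restrictField (Place.Completion q))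
          L hL).comap locW) =
        Module.length R ↥(galoisCohomology.submoduleOfStable hρ
          (S ⊓ E ⊓ L.comap (galoisCohomology.localization ρ q 1))
          (stable_inf ρ hρ (stable_inf ρ hρ hS hE) (stable_comap ρ hρ q hL))) := by
    intro L hL
    have hle : galoisCohomology.submoduleOfStable hρ
        (S ⊓ E ⊓ L.comap (galoisCohomology.localization ρ q 1))
        (stable_inf ρ hρ (stable_inf ρ hρ hS hE) (stable_comap ρ hρ q hL)) ≤ W :=
      fun x hx => hx.1
    have heq : (galoisCohomology.submoduleOfStable (hρ.restrictField (Place.Completion q)) L hL).comap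
        locW = Submodule.comap W.subtype (galoisCohomology.submoduleOfStable hρ
          (S ⊓ E ⊓ L.comap (galoisCohomology.localization ρ q 1))
          (stable_inf ρ hρ (stable_inf ρ hρ hS hE) (stable_comap ρ hρ q hL))) := by
      refine Submodule.ext fun w => ?_
      simp only [Submodule.mem_comap, galoisCohomology.mem_submoduleOfStable_iff,
        Submodule.subtype_apply, AddSubgroup.mem_inf, AddSubgroup.mem_comap]
      exact ⟨fun h => ⟨w.2, h⟩, fun h => h.2⟩
    rw [heq]
    exact (Submodule.comapSubtypeEquivOfLe hle).length_eq
  refine ⟨?_, ?_⟩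
  · rw [← hident Lt hLt, ← hident Lf hLf]
    exact hlen
  · rw [eq_bot_iff]
    rintro _ ⟨x, hx, rfl⟩
    rw [AddSubgroup.mem_bot]
    have hmem : locW ⟨x, hx.1⟩ ∈ (Lt'.comap locW).map locW :=
      Submodule.mem_map_of_mem (show (⟨x, hx.1⟩ : W) ∈ Lt'.comap locW from hx.2)
    rw [hbot, Submodule.mem_bot] at hmem
    exact hmem

/-- **Howard's Lemma 1.5.3 (b) in eigen-Selmer currency.** Same setting; if every `c ∈ S ⊓ E` with
`loc_q c ∈ Lf` has `loc_q c = 0` («`loc_ℓ(𝓗̄(n)^±) = 0`») then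
`length (S ⊓ E ⊓ loc⁻¹ Lt) = length (S ⊓ E ⊓ loc⁻¹ Lf) + 1` («`ρ(nℓ)^± = ρ(n)^± + 1`»).
[cite: Howard2004HeegnerKolyvagin, Lemma 1.5.3 (b) (arXiv 2.5.3, p. 9 L145–146; proof p. 10 L21–45)] -/
theorem length_inf_comap_eq_add_one_of_forall (hdis : Disjoint Lf Lt)
    (hGD : letI := galoisCohomology.moduleH1 (ρ.toLocal q) (hρ.restrictField (Place.Completion q));
      Module.length R ↥(galoisCohomology.submoduleOfStable (hρ.restrictField (Place.Completion q))
        ((S ⊓ E).map (galoisCohomology.localization ρ q 1)) (stable_map ρ hρ q (stable_inf ρ hρ hS hE)))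
        = 1)
    (hor : (S ⊓ E).map (galoisCohomology.localization ρ q 1) ≤ Lf ∨
      (S ⊓ E).map (galoisCohomology.localization ρ q 1) ≤ Lt)
    (hzero : ∀ c ∈ S ⊓ E, galoisCohomology.localization ρ q 1 c ∈ Lf →
      galoisCohomology.localization ρ q 1 c = 0) :
    (letI := galoisCohomology.moduleH1 ρ hρ;
      Module.length R ↥(galoisCohomology.submoduleOfStable hρ
          (S ⊓ E ⊓ Lt.comap (galoisCohomology.localization ρ q 1))
          (stable_inf ρ hρ (stable_inf ρ hρ hS hE) (stable_comap ρ hρ q hLt))) =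
        Module.length R ↥(galoisCohomology.submoduleOfStable hρ
          (S ⊓ E ⊓ Lf.comap (galoisCohomology.localization ρ q 1))
          (stable_inf ρ hρ (stable_inf ρ hρ hS hE) (stable_comap ρ hρ q hLf))) + 1) := by
  classical
  letI instR := galoisCohomology.moduleH1 ρ hρ
  letI instL := galoisCohomology.moduleH1 (ρ.toLocal q) (hρ.restrictField (Place.Completion q))
  letI instL' := galoisCohomology.moduleH1 (GaloisRep.restrictField (Place.Completion q) ρ)
    (hρ.restrictField (Place.Completion q))
  -- the `R`-submodules
  let W : Submodule R (galoisCohomology ρ 1) :=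
    galoisCohomology.submoduleOfStable hρ (S ⊓ E) (stable_inf ρ hρ hS hE)
  let Lf' : Submodule R (galoisCohomology (ρ.toLocal q) 1) :=
    galoisCohomology.submoduleOfStable (hρ.restrictField (Place.Completion q)) Lf hLf
  let Lt' : Submodule R (galoisCohomology (ρ.toLocal q) 1) :=
    galoisCohomology.submoduleOfStable (hρ.restrictField (Place.Completion q)) Lt hLt
  let locW : W →ₗ[R] galoisCohomology (ρ.toLocal q) 1 :=
    (galoisCohomology.resₗ hρ (Place.Completion q)).domRestrict W
  have hlocW : ∀ w : W, locW w = galoisCohomology.localization ρ q 1 (w : galoisCohomology ρ 1) :=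
    fun w => rfl
  have hdis' : Disjoint Lf' Lt' := by
    rw [Submodule.disjoint_def]
    intro x hxf hxt
    exact (AddSubgroup.disjoint_def.mp hdis) hxf hxt
  have hrange : LinearMap.range locW =
      galoisCohomology.submoduleOfStable (hρ.restrictField (Place.Completion q))
        ((S ⊓ E).map (galoisCohomology.localization ρ q 1))
        (stable_map ρ hρ q (stable_inf ρ hρ hS hE)) := by
    refine Submodule.ext fun y => ?_
    rw [LinearMap.mem_range]
    change (∃ w, locW w = y) ↔ y ∈ (S ⊓ E).map (galoisCohomology.localization ρ q 1)
    rw [AddSubgroup.mem_map]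
    constructor
    · rintro ⟨w, rfl⟩
      exact ⟨w, w.2, (hlocW w).symm⟩
    · rintro ⟨x, hx, rfl⟩
      exact ⟨⟨x, hx⟩, hlocW _⟩
  have hor' : LinearMap.range locW ≤ Lf' ∨ LinearMap.range locW ≤ Lt' := by
    rw [hrange]
    rcases hor with h | h
    · exact Or.inl fun y hy => h hy
    · exact Or.inr fun y hy => h hy
  have heq' : (Lf'.comap locW).map locW = ⊥ := by
    rw [eq_bot_iff]
    rintro _ ⟨w, hw, rfl⟩
    rw [Submodule.mem_bot, hlocW]
    exact hzero _ w.2 hw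
  have hGD' : Module.length R (LinearMap.range locW) = 1 := by rw [hrange]; exact hGD
  have hlen :=
    Literature.Algebra.Module.LinearMap.length_comap_eq_add_one_of_map_comap_eq_bot locW hdis' hor'
      hGD' heq'
  -- identify the two comaps with the subgroups `S ⊓ E ⊓ loc⁻¹ L`
  have hident : ∀ (L : AddSubgroup (galoisCohomology (ρ.toLocal q) 1))
      (hL : ∀ (r : R) {x}, x ∈ L →
        galoisCohomology.scalarMapH1 (ρ.toLocal q) (hρ.restrictField (Place.Completion q)) r x ∈ L),
      Module.length R ↥((galoisCohomology.submoduleOfStable (hρ.restrictField (Place.Completion q))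
          L hL).comap locW) =
        Module.length R ↥(galoisCohomology.submoduleOfStable hρ
          (S ⊓ E ⊓ L.comap (galoisCohomology.localization ρ q 1))
          (stable_inf ρ hρ (stable_inf ρ hρ hS hE) (stable_comap ρ hρ q hL))) := by
    intro L hL
    have hle : galoisCohomology.submoduleOfStable hρ
        (S ⊓ E ⊓ L.comap (galoisCohomology.localization ρ q 1))
        (stable_inf ρ hρ (stable_inf ρ hρ hS hE) (stable_comap ρ hρ q hL)) ≤ W :=
      fun x hx => hx.1
    have heq : (galoisCohomology.submoduleOfStable (hρ.restrictField (Place.Completion q)) L hL).comap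
        locW = Submodule.comap W.subtype (galoisCohomology.submoduleOfStable hρ
          (S ⊓ E ⊓ L.comap (galoisCohomology.localization ρ q 1))
          (stable_inf ρ hρ (stable_inf ρ hρ hS hE) (stable_comap ρ hρ q hL))) := by
      refine Submodule.ext fun w => ?_
      simp only [Submodule.mem_comap, galoisCohomology.mem_submoduleOfStable_iff,
        Submodule.subtype_apply, AddSubgroup.mem_inf, AddSubgroup.mem_comap]
      exact ⟨fun h => ⟨w.2, h⟩, fun h => h.2⟩
    rw [heq]
    exact (Submodule.comapSubtypeEquivOfLe hle).length_eq
  rw [← hident Lt hLt, ← hident Lf hLf]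
  exact hlen

end Parity

end Literature.NumberTheory.GaloisCohomology.Howard2004
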